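import Summits.CriticalPhenomena.PercolationContinuityZ3.Theorems.PercNearOneGluingNoHeavyLowerTailSunflowerMultiPetalLocalMatching
import HarnessLib
import HarnessLib.Audit

/-!
# `NoHeavyLowerTail` (crux stmt-CriticalPhenomena-4575), abstract sunflower cubic, `k` petals: the HOME-ROUTING Hall forms
# (pairs stay home, rainbows move along a comparable spectator), `HomeRoutingK ⟹ PartitionLemmaK`, and the FLIP form (Conjecture G)

Support file (seat `prim-l12-p2` gen 30; `--supports stmt-CriticalPhenomena-4575`; companion of `…SunflowerMultiPetalLocalMatching`
(p344154: `slotParts`, `badParts`, `ZK_eq_slot`, `ZK_nonneg_iff_card`, `DoubledCubeHallK`), `…SunflowerMultiPetalIntervalHall` (p356166: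
`IntervalHallK`) and `…SunflowerMultiPetal` (p338110: `MSunflower`, `PartitionLemmaK`)).  No `sorry`; the three `@[conjecture]` definitions are
obligations of the programme, never facts.  Memo: run/shared/lean/prim/prim-l12/prim-l12-p2/FINDING-g30-HOME-ROUTING.md.

VOCABULARY.  A slot is an ordered 3-partition `(K; S; T)` (`K` decided = top or bottom, `S` top, `T` bottom; coded `(K, S)`, `T = (K ∪ S)ᶜ`).
A bad ordered partition has pairwise distinct labels and at most one decided block: either a PAIR-DEMAND (one decided block `X`, its
'spectator', and two separated petal blocks) or a RAINBOW (three petal blocks).  `PartitionLemmaK` ⟺ `#badParts ≤ 6 · #slotParts`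
(`ZK_nonneg_iff_card`), so ANY injective assignment `badParts → slotParts × Fin 6` proves it; the Hall forms below prescribe WHICH slots a
bad partition may use.

THE STATEMENTS (this work).
* `HomeRoutingK` (unoriented form, `MSunflower.HomeAdj`): a pair-demand with spectator `X` must use a slot with THE SAME spectator
  `K = X` ('pairs stay home': any good `(S,T)` of its own cube `Xᶜ`); a rainbow `{F¹,F²,F³}` must use a slot `(K; S; T)` whose interval
  `[T, T ∪ S]` contains one of its blocks (`T ⊆ Fⁱ`, `Fⁱ ∩ K = ∅`) AND whose spectator is COMPARABLE with one of its blocks (`K ⊆ Fʲ` or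
  `Fʲ ⊆ K`; as `K` is decided and `Fʲ` is a petal block this means: `K` bottom inside a block, or `K` top containing a block).
* `HomeRoutingOrientedK` (rigid form, `MSunflower.HomeAdjOr`): in addition the pair-demands are ORIENTED by the petal index — the top block
  `S` of the home slot contains the petal half with the SMALLER label (the shape of prim-ineq-gen-3's transitive-tournament antipodal Hall
  theorem `OrientedAntipodalHall.exists_injective_good_above_transitiveTournament`, which proves exactly this part cube by cube) — and a
  rainbow has only two moves: (Rw) `K ⊆ Fʲ` bottom, `T ⊆ Fⁱ` bottom (`i ≠ j`), `S` = the rest; (Rb) `K = Fʲ ∪ Y` top with `Y ⊆ Fˡ` bottom,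
  `T = ∅`, `S = Fⁱ ∪ (Fˡ \ Y)` top.
* `homeAdj_of_homeAdjOr`, `homeRoutingK_of_homeRoutingOrientedK`: the rigid form implies the unoriented one;
  `partitionLemmaK_of_homeRoutingK`, `partitionLemmaK_of_homeRoutingOrientedK`: either implies ★ₖ (cardinalities + the slot form).
* `MSunflower.ZKflip D` (the partition functional with every block replaced by its symmetric difference with `D`), `ZKflip_empty`,
  `FlipPartitionLemmaK` (Conjecture G of the memo: `0 ≤ ZKflip D` for every `D` — ★ₖ is a property of UNATE structures, equivalently of three
  random sets with independent EXCHANGEABLE coordinate patterns; closed under gadget composition by the module identity of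
  `…SunflowerMultiPetalModule`), `partitionLemmaK_of_flipPartitionLemmaK`.

CENSUS (memo §2; exact bipartite matchings, finest colouring, this seat).  Both forms: ALL `(A,B)` pairs on ≤ 5 points with ≥ 3 components
and ≥ 1 rainbow (2 757 463 instances, 11 256 930 demands): 0 Hall failures; structured battery to 8 points (all co-stars, threshold stars,
AND/atom products incl. the doubled star and the 6-point witnesses of the refuted (LM)/(LI)/reading variants; 6 petal orders each): 0;
Hall-surplus-driven adversarial local search, 6 and 7 points, 4 petal orders, ≈ 3.8·10⁶ evaluations: 0 (minimum Hall surplus 0, never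
negative); **EXHAUSTIVE 6-point census (kit j188602, evidence on the item): `U` canonical mod `S₆`, all `A ⊆ U` — 3 536 003 141 instances with ≥ 3
components, 26 450 439 270 demands, 285 473 157 rainbows: 0 Hall failures for both forms and for every fixed orientation of the two rainbow moves.**  DEAD neighbours (memo §3): rainbows through bottom spectators only
(doubled star) or top spectators only; `T = ∅` forced; `K = ∅` forced in (Rw); every single FIXED orientation of (Rw); and the LOCAL
versions 'per petal set G' (count and matching) — refuted on 6 points.
-/

namespace Summit.CriticalPhenomena.PercolationContinuityZ3.Theorems.SunflowerPartition

open Finset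

namespace MSunflower

variable {α : Type*} [DecidableEq α] [Fintype α] {k : ℕ} (F : MSunflower k α)

/-- HOME adjacency (unoriented) of a bad ordered partition `q` (blocks `q.1, q.2, (q.1 ∪ q.2)ᶜ`) and a slot `s = (K, S)` (`T = (K ∪ S)ᶜ`):
either some block `X` of `q` is decided and IS the spectator of the slot (`s.1 = X`: the pair-demand stays in its own cube); or no block of
`q` is decided (a rainbow), the interval `[T, T ∪ S]` of the slot contains a block `X` of `q`, and the spectator `K` is comparable with a
block `Y` of `q`. [this work] -/
def HomeAdj (q s : Finset α × Finset α) : Prop :=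
  (∃ X : Finset α, (X = q.1 ∨ X = q.2 ∨ X = (q.1 ∪ q.2)ᶜ) ∧ (F.lab X = Fin.last (k + 1) ∨ F.lab X = 0) ∧ s.1 = X) ∨
  ((¬ (F.lab q.1 = Fin.last (k + 1) ∨ F.lab q.1 = 0) ∧ ¬ (F.lab q.2 = Fin.last (k + 1) ∨ F.lab q.2 = 0) ∧
      ¬ (F.lab (q.1 ∪ q.2)ᶜ = Fin.last (k + 1) ∨ F.lab (q.1 ∪ q.2)ᶜ = 0)) ∧
    ∃ X Y : Finset α, (X = q.1 ∨ X = q.2 ∨ X = (q.1 ∪ q.2)ᶜ) ∧ (Y = q.1 ∨ Y = q.2 ∨ Y = (q.1 ∪ q.2)ᶜ) ∧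
      (s.1 ∪ s.2)ᶜ ⊆ X ∧ Disjoint X s.1 ∧ (s.1 ⊆ Y ∨ Y ⊆ s.1))

/-- HOME adjacency, ORIENTED / rigid form: a pair-demand with decided block `X` and petal blocks `P, P'` with `lab P < lab P'` uses a slot
with spectator `X` whose top block contains `P`; a rainbow with blocks `(X, Y, Z)` (some ordering of its three petal blocks) uses either
(Rw) a slot with BOTTOM spectator `K ⊆ Y` and bottom block `T ⊆ X`, or (Rb) the slot `(Y ∪ W; X ∪ (Z \ W); ∅)` with TOP spectator
`K = Y ∪ W`, `W ⊆ Z` of bottom label, and `T = ∅`. [this work] -/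
def HomeAdjOr (q s : Finset α × Finset α) : Prop :=
  (∃ X P P' : Finset α,
      ((X = q.1 ∧ P = q.2 ∧ P' = (q.1 ∪ q.2)ᶜ) ∨ (X = q.1 ∧ P = (q.1 ∪ q.2)ᶜ ∧ P' = q.2) ∨
        (X = q.2 ∧ P = q.1 ∧ P' = (q.1 ∪ q.2)ᶜ) ∨ (X = q.2 ∧ P = (q.1 ∪ q.2)ᶜ ∧ P' = q.1) ∨
        (X = (q.1 ∪ q.2)ᶜ ∧ P = q.1 ∧ P' = q.2) ∨ (X = (q.1 ∪ q.2)ᶜ ∧ P = q.2 ∧ P' = q.1)) ∧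
      (F.lab X = Fin.last (k + 1) ∨ F.lab X = 0) ∧ F.lab P < F.lab P' ∧ s.1 = X ∧ P ⊆ s.2) ∨
  ((¬ (F.lab q.1 = Fin.last (k + 1) ∨ F.lab q.1 = 0) ∧ ¬ (F.lab q.2 = Fin.last (k + 1) ∨ F.lab q.2 = 0) ∧
      ¬ (F.lab (q.1 ∪ q.2)ᶜ = Fin.last (k + 1) ∨ F.lab (q.1 ∪ q.2)ᶜ = 0)) ∧
    ∃ X Y Z : Finset α,
      ((X = q.1 ∧ Y = q.2 ∧ Z = (q.1 ∪ q.2)ᶜ) ∨ (X = q.1 ∧ Y = (q.1 ∪ q.2)ᶜ ∧ Z = q.2) ∨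
        (X = q.2 ∧ Y = q.1 ∧ Z = (q.1 ∪ q.2)ᶜ) ∨ (X = q.2 ∧ Y = (q.1 ∪ q.2)ᶜ ∧ Z = q.1) ∨
        (X = (q.1 ∪ q.2)ᶜ ∧ Y = q.1 ∧ Z = q.2) ∨ (X = (q.1 ∪ q.2)ᶜ ∧ Y = q.2 ∧ Z = q.1)) ∧
      ((F.lab s.1 = 0 ∧ s.1 ⊆ Y ∧ (s.1 ∪ s.2)ᶜ ⊆ X) ∨
        (F.lab s.1 = Fin.last (k + 1) ∧ s.1 ∪ s.2 = univ ∧ Y ⊆ s.1 ∧ s.1 ⊆ Y ∪ Z ∧ F.lab (s.1 \ Y) = 0)))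

/-- The rigid adjacency implies the unoriented one (for a genuine ordered partition `q`, i.e. `q.1 ∩ q.2 = ∅`). [this work] -/
theorem homeAdj_of_homeAdjOr {q s : Finset α × Finset α} (hq : Disjoint q.1 q.2) (h : F.HomeAdjOr q s) :
    F.HomeAdj q s := by
  rcases h with ⟨X, P, P', hXPP, hdec, -, hsX, -⟩ | ⟨hrb, X, Y, Z, hXYZ, hmove⟩
  · refine Or.inl ⟨X, ?_, hdec, hsX⟩
    rcases hXPP with ⟨hX, -, -⟩ | ⟨hX, -, -⟩ | ⟨hX, -, -⟩ | ⟨hX, -, -⟩ | ⟨hX, -, -⟩ | ⟨hX, -, -⟩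
    · exact Or.inl hX
    · exact Or.inl hX
    · exact Or.inr (Or.inl hX)
    · exact Or.inr (Or.inl hX)
    · exact Or.inr (Or.inr hX)
    · exact Or.inr (Or.inr hX)
  · refine Or.inr ⟨hrb, ?_⟩
    have d13 : Disjoint q.1 (q.1 ∪ q.2)ᶜ :=
      disjoint_compl_right.mono_right (compl_subset_compl.2 subset_union_left)
    have d23 : Disjoint q.2 (q.1 ∪ q.2)ᶜ :=
      disjoint_compl_right.mono_right (compl_subset_compl.2 subset_union_right)
    -- blocks, and the disjointness of `X` from `Y` and from `Z`, in each of the six orderings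
    have key : (X = q.1 ∨ X = q.2 ∨ X = (q.1 ∪ q.2)ᶜ) ∧ (Y = q.1 ∨ Y = q.2 ∨ Y = (q.1 ∪ q.2)ᶜ) ∧
        Disjoint X Y ∧ Disjoint X Z := by
      rcases hXYZ with ⟨rfl, rfl, rfl⟩ | ⟨rfl, rfl, rfl⟩ | ⟨rfl, rfl, rfl⟩ | ⟨rfl, rfl, rfl⟩ | ⟨rfl, rfl, rfl⟩ |
        ⟨rfl, rfl, rfl⟩
      · exact ⟨Or.inl rfl, Or.inr (Or.inl rfl), hq, d13⟩
      · exact ⟨Or.inl rfl, Or.inr (Or.inr rfl), d13, hq⟩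
      · exact ⟨Or.inr (Or.inl rfl), Or.inl rfl, hq.symm, d23⟩
      · exact ⟨Or.inr (Or.inl rfl), Or.inr (Or.inr rfl), d23, hq.symm⟩
      · exact ⟨Or.inr (Or.inr rfl), Or.inl rfl, d13.symm, d23.symm⟩
      · exact ⟨Or.inr (Or.inr rfl), Or.inr (Or.inl rfl), d23.symm, d13.symm⟩
    obtain ⟨hXb, hYb, hXY, hXZ⟩ := key
    rcases hmove with ⟨-, hKY, hTX⟩ | ⟨-, hKS, hYK, hKYZ, -⟩
    · exact ⟨X, Y, hXb, hYb, hTX, hXY.mono_right hKY, Or.inl hKY⟩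
    · refine ⟨X, Y, hXb, hYb, ?_, (hXY.sup_right hXZ).mono_right hKYZ, Or.inr hYK⟩
      rw [hKS, compl_univ]
      exact empty_subset _

end MSunflower

/-- **HOME-ROUTING CONJECTURE, unoriented form** (this work; OPEN; census in the header): for every `k`, every finite `α` and every monotone map
`2^α → M_k`, the bad ordered partitions admit an injective assignment to slots-with-multiplicity-six such that pair-demands stay in the cube of
their own spectator and rainbows use slots whose interval contains one of their blocks and whose spectator is comparable with one of their
blocks — `MSunflower.HomeAdj`.  Implies `PartitionLemmaK` (`partitionLemmaK_of_homeRoutingK`).  An obligation, never a fact: use as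
`(h : HomeRoutingK)`. [status: open] -/
@[conjecture] def HomeRoutingK : Prop :=
  ∀ (k : ℕ) (α : Type) [Fintype α] [DecidableEq α] (F : MSunflower k α),
    ∃ ψ : ↥F.badParts → ↥F.slotParts × Fin 6, Function.Injective ψ ∧ ∀ q, F.HomeAdj q.1 (ψ q).1.1

/-- **HOME-ROUTING CONJECTURE, rigid (oriented) form** (this work; OPEN; census in the header): as `HomeRoutingK`, but pair-demands are
oriented by the petal index (the top block of the home slot contains the petal half of smaller label — prim-ineq-gen-3's transitive-tournament
shape) and rainbows have only the two moves (Rw)/(Rb) of `MSunflower.HomeAdjOr`.  Implies `HomeRoutingK` and `PartitionLemmaK`.  An obligation,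
never a fact: use as `(h : HomeRoutingOrientedK)`. [status: open] -/
@[conjecture] def HomeRoutingOrientedK : Prop :=
  ∀ (k : ℕ) (α : Type) [Fintype α] [DecidableEq α] (F : MSunflower k α),
    ∃ ψ : ↥F.badParts → ↥F.slotParts × Fin 6, Function.Injective ψ ∧ ∀ q, F.HomeAdjOr q.1 (ψ q).1.1

/-- **Home routing ⟹ ★ₖ** (cardinalities + the slot form `ZK = 6·#slots − #bads`). [this work] -/
theorem partitionLemmaK_of_homeRoutingK (h : HomeRoutingK) : PartitionLemmaK := by
  intro k α _ _ F
  obtain ⟨ψ, hψ, -⟩ := h k α F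
  rw [F.ZK_nonneg_iff_card]
  have hc := Fintype.card_le_of_injective ψ hψ
  rw [Fintype.card_prod, Fintype.card_fin, Fintype.card_coe, Fintype.card_coe] at hc
  linarith

/-- The rigid form implies the unoriented form. [this work] -/
theorem homeRoutingK_of_homeRoutingOrientedK (h : HomeRoutingOrientedK) : HomeRoutingK := by
  intro k α _ _ F
  obtain ⟨ψ, hψ, hadj⟩ := h k α F
  refine ⟨ψ, hψ, fun q => F.homeAdj_of_homeAdjOr ?_ (hadj q)⟩
  have hq := q.2
  simp only [MSunflower.badParts, Finset.mem_filter, parts] at hq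
  exact hq.1.2

/-- **Rigid home routing ⟹ ★ₖ**. [this work] -/
theorem partitionLemmaK_of_homeRoutingOrientedK (h : HomeRoutingOrientedK) : PartitionLemmaK :=
  partitionLemmaK_of_homeRoutingK (homeRoutingK_of_homeRoutingOrientedK h)



/-! ## The flip (partial complementation) form — Conjecture G of the memo -/

namespace MSunflower

variable {α : Type*} [DecidableEq α] [Fintype α] {k : ℕ} (F : MSunflower k α)

/-- The FLIPPED partition functional: `ZK` with every block replaced by its symmetric difference with a fixed set `D`
(so the elements of `D` lie in exactly two of the three 'blocks', the others in exactly one).  `ZKflip ∅ = ZK`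
(`ZKflip_empty`). [this work] -/
def ZKflip (D : Finset α) : ℤ :=
  ∑ q ∈ parts α, s6K k (F.lab (symmDiff q.1 D)) (F.lab (symmDiff q.2 D)) (F.lab (symmDiff (q.1 ∪ q.2)ᶜ D))

/-- `ZKflip ∅ = ZK`. [this work] -/
theorem ZKflip_empty : F.ZKflip ∅ = F.ZK := by
  unfold ZKflip ZK
  have h : ∀ s : Finset α, symmDiff s ∅ = s := fun s => symmDiff_bot s
  simp only [h]

end MSunflower

/-- **FLIP CONJECTURE (G)** (this work; OPEN; census memo §5: ALL structures on ≤ 5 points × ALL membership patterns — 4 points: 3 909 structures,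
1 000 704 coefficients; 5 points (kit j189326, evidence on the item): 5 740 779 structures, 5 878 557 696 coefficients — 0 negative; adversarial 5–7 points
≈ 5·10⁷ coefficients: 0 negative; all hard 6-point instances × all 64 `D`: 0 negative; NON-exchangeable patterns fail already on 3 points): for every `k`, every finite `α`, every monotone map
`2^α → M_k` and EVERY subset `D ⊆ α`, the flipped partition functional is nonnegative: `0 ≤ ZKflip D`.  `D = ∅` is `PartitionLemmaK`
(`partitionLemmaK_of_flipPartitionLemmaK`); `D = univ` is `PartitionLemmaK` for the complemented (dual) structure; a general `D` is the
statement for the UNATE structure obtained by reversing the coordinates in `D` — equivalently, coefficient-wise nonnegativity of the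
partition functional of every composition of the structure with disjoint monotone gadgets, or: `E[N_top · N_bot − 1_{three distinct labels}] ≥ 0`
for three random subsets whose coordinate membership patterns are independent and EXCHANGEABLE.  An obligation, never a fact: use as
`(h : FlipPartitionLemmaK)`. [status: open] -/
@[conjecture] def FlipPartitionLemmaK : Prop :=
  ∀ (k : ℕ) (α : Type) [Fintype α] [DecidableEq α] (F : MSunflower k α) (D : Finset α), 0 ≤ F.ZKflip D

/-- **(G) ⟹ ★ₖ** (`D = ∅`). [this work] -/
theorem partitionLemmaK_of_flipPartitionLemmaK (h : FlipPartitionLemmaK) : PartitionLemmaK := by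
  intro k α _ _ F
  rw [← F.ZKflip_empty]
  exact h k α F ∅

end Summit.CriticalPhenomena.PercolationContinuityZ3.Theorems.SunflowerPartition
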